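import Summits.QuantumFields.YangMills.Theorems.UnitScaleTiltHistoryTailLaneTailV4ChiDisplays
import Summits.QuantumFields.YangMills.Theorems.AlphaInputsT3ACv3XsSelectionOfSizes
import Summits.QuantumFields.YangMills.Theorems.AlphaInputsT3ACv3ProfileLargeRec
import HarnessLib

/-!
# `UnitScaleTiltHistoryTailLaneTailV4ChiDisplaysArgmin` — crux `HistoryTailL` (stmt-QuantumFields-19936): THE ONE-SUPPLIER v4 DOOR WITH THE SELECTION EXISTENCE DISCHARGED
# (door v1.2; LEAD ym-ust-19936-w1 g4, X-chain consumer side; cell `ym3-torus`)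

WHAT THIS FILE CHANGES IN THE DISPLAY, by name.  The Sel∕Xs door of record ✓`HistoryTailLaneTailV4Chi.historyTailL_of_thm1In8_selXsV4DataRows_allL` reads NODE O's rows as
«`(∃ Ut, TrivMinimiserRowsT3 …) → ∃ Ut, TrivMinimiserRowsT3 … ∧ DataRowsT3XsChiSel … Ut`», and (O‴χₛ) `DataRowsT3XsChiSel` opens with an EXISTENCE conjunct
`∃ UkH (hU0), InClassSelT3Xs … Ut UkH` (a measurable minimiser selection in the one-currency class `𝒞_Xs`, pinned to `Ut` at the trivial histories).  That conjunct is
now a THEOREM at the record sizes — ★w5-19936 g4's ✓`AlphaInputsT3AC.exists_inClassSelT3Xs_of_trivMinimiserRows_of_sizes_of_profRec` modulo the enlarged-profile recording row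
(U2) (measurable ARGMIN of `wilsonAction4` over `𝒞_Xs(k, h, W)` at every admissible non-trivial history, glued to `Ut` at the trivial ones; non-emptiness from the inner
exact lift (EL) ✓`innerExactLiftT3_of_sizes` + the charged glue ✓`…ChargedGlueXs`; closedness∕selector ✓`…XsClassSelector`), and (U2) itself is ★w4-19936 g5's
✓`AlphaInputsT3AC.profRec_of_collar` (abelian flux rigidity of the symmetric `blockAvg ℰp` tower, ✓`…AbelianCurlIter` ∕ ✓`…ProfileRegionEML` ∕ ✓`…ProfileLargeRec`).
THIS FILE folds both theorems into the door:
* `AlphaInputsT3AC.dataRowsT3XsChiSel_of_argminSocket` — at one `(F, 𝔠, γ, K)`: the record sizes + the `B₃`-floor + (U2) + `TrivMinimiserRowsT3 … Ut` + the ARGMIN SOCKET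
  «for EVERY measurable selection `UkH` with `hU0`, `InClassSelT3Xs … Ut UkH` and the argmin property, NODE O's three data conjuncts for `UkH`» ⟹ `DataRowsT3XsChiSel … Ut`;
* `AlphaInputsT3AC.dataRowsT3XsChiSel_of_argminSocket_of_sizes` (∕ `…_cast`) — the same at the record sizes with (U2) DISCHARGED (★w4-19936 g5's ✓`AlphaInputsT3AC.profRec_of_collar`
  at `collarE_T3_of_M₁_ge` ∕ `four_pi_le_C68_of_sizes`), along `hF : F.L = L` for a record `𝔠 : AlphaConsts L _` (the door's `hF ▸ 𝔠` letters);
* ★★★ `HistoryTailLaneTailV4Chi.historyTailL_of_thm1In8_xsArgminRows_allL` — THE DOOR v1.2: `HistoryTailL` ⇐ ⟨`hT8` VERBATIM as in the door of record⟩ ∧ ⟨`hrows` with the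
  consequent RE-DISPLAYED as: the collar size `7L + 3 ≤ 𝔠.M₁` (free bookkeeping, ✓`exists_record_sizes_M₁_gamma0`), the seam row (71)_sym (unchanged), and per `(γ, K)` and
  per handed trivial-history family `Ut`: the ARGMIN SOCKET only⟩.  The `B₃`-floor of the selection theorem is ABSORBED (the door raises the supplier's floor `B₀` to
  `max B₀ (b3Floor L)`; `hrows` is served for every `B ≥ B₀`, so nothing is asked of the supplier).
So the displayed residue of 19936 under this door reads BY NAME: (T) `Thm1GlobalMinAt ∧ MinimisersIn8At` (= 19200 H ∧ EX via ✓`thm1In8GlobalMin_of_halvingStep_of_existence`) +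
NODE O d = 3's three data conjuncts FOR AN IN-CLASS ARGMIN — and nothing else (no kinematic row, no (U2), no (FL), no comb letter, no collar hypothesis).  The socket is the WEAKEST demand on NODE O among the honest ones (NODE O may use class membership AND minimality; [Balaban1985Variational] Thm 1's regional
regularity of that argmin re-enters INSIDE NODE O, BILL §3 L2).
HONEST FRAMING.  Bookkeeping over landed theorems; the displayed rows are HYPOTHESIS SCHEMAS (never asserted); nothing of [Balaban1985UV3]'s cluster expansion or
[Balaban1985Variational] Thm 1 is proved; count-neutral helper (`--supports stmt-QuantumFields-19936`); registry untouched.  YM₃ on the three-torus is rung R3 of the programme,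
NOT the Clay problem; no claim about d = 4, infinite volume, or a mass gap.
[cite: Balaban1985UV3, (5) p.256, (42) p.266, (47) p.267, (67)–(71) p.273 and Thm 2 p.272; Balaban1985Variational, Thm 1 (6)–(8) pp.278–279 and Prop 8 p.304; King1986, (3.12) p.657]
-/

set_option autoImplicit false

noncomputable section

namespace Summit.QuantumFields.YangMills.Theorems

open MeasureTheory Set
open scoped Matrix Matrix.Norms.L2Operator
open Literature.MathematicalPhysics.QuantumFieldTheory.Balaban1983to89
open Literature.MathematicalPhysics.QuantumFieldTheory.Balaban1983to89.T3ContinuumYM3Torus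
open Literature.MathematicalPhysics.QuantumFieldTheory.Balaban1983to89.ExpMeanLog (deltaSU)
open Literature.MathematicalPhysics.QuantumFieldTheory.Balaban1985CMP102
open Literature.MathematicalPhysics.QuantumFieldTheory.Balaban1985CMP102.Setting
open Summit.QuantumFields.Balaban3D.Carriers
open Summit.QuantumFields.Balaban3D.Proofs.Primitives
open Summit.QuantumFields.Balaban3D.Proofs.GroupModelLieC (lieC)
open Summit.QuantumFields.Balaban3D.Proofs.TowerAC
open Summit.QuantumFields.Balaban3D.Proofs.StandardAC
open Summit.QuantumFields.Balaban3D.Proofs.InputsAC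
open Summit.QuantumFields.Balaban3D.Proofs.AlphaAC (AlphaDataAC)
open Summit.QuantumFields.Balaban3D.Proofs.Thresholds (Q0)
open Summit.QuantumFields.YangMills.Theorems.AlphaV3AC
open Summit.QuantumFields.YangMills.Theorems.ProfileEnlarged (profE)
open B7Prop2Explicit (C0)

/-! ## §1 (O‴χₛ) from the trivial-history rows, the sizes, (U2) and the argmin socket — one `(F, 𝔠, γ, K)` -/

section T3

variable {F : T3Family} {𝔠 : AlphaConsts F.L (suGroupModel 2).N} {γ : ℝ} {hγ : 0 < γ} {hγ1 : γ ≤ (min 𝔠.gamma0 1) ^ 2} {K : ℕ}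

/-- ★★ **(O‴χₛ) `DataRowsT3XsChiSel … Ut` FROM THE ARGMIN SOCKET**: at the record sizes (small-`a₁` rows, `1 ≤ 2B₃`, the three `C68`-rows, the collar `7L + 3 ≤ M₁`, the
`B₃`-floor of (EL)), under (U2) «the enlarged-region profile is (67)-large in recording currency at every admissible history», the trivial-history rows of `Ut` and the
socket «NODE O's three χ-data conjuncts for EVERY measurable in-class ARGMIN selection pinned to `Ut`», the selection conjunct of (O‴χₛ) is discharged by ★w5-19936 g4's
`exists_inClassSelT3Xs_of_trivMinimiserRows_of_sizes_of_profRec` and the data conjuncts are read off the socket at that selection.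
[cite: Balaban1985UV3, (42) p.266, (67)–(68) p.273 and Thm 2 p.272; Balaban1985Variational, Thm 1 (8) p.279] -/
theorem AlphaInputsT3AC.dataRowsT3XsChiSel_of_argminSocket {a₀ a₁ : ℝ} (ha₁ : 0 < a₁)
    (hA3 : (143 * ((((3 + 4 : ℕ) : ℝ)) ^ 2 / 4) ^ 2) * (2 * (𝔠.B₃ * a₁)) ≤ 1 / 3)
    (hA2 : 2 * (2 * (𝔠.B₃ * a₁)) ≤ 2 * deltaSU (Fin 2) / (((3 + 4) * F.L : ℕ) : ℝ) ^ 2)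
    (hB₃ : 1 ≤ 2 * 𝔠.B₃) (hC : 4 * 𝔠.B₃ * (F.L : ℝ) ^ 2 * avgWindowFactor F.L ≤ 𝔠.C68)
    (hCe : Real.exp (𝔠.p₀ - 1) ≤ 3 * C0 3 * 𝔠.C68 * (𝔠.b₀ * Q0 𝔠.p₀))
    (hCa : (𝔠.b₀ * Q0 𝔠.p₀) * (2 * (F.L : ℝ) ^ 2 * avgWindowFactor F.L) ^ 2 ≤ 3 * C0 3 * 𝔠.C68 * a₁ ^ 2)
    (hM : 7 * F.L + 3 ≤ 𝔠.M₁)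
    (hBfl : max (max ((10 : ℝ) ^ 27 + 1) 257 * (F.L : ℝ) ^ 2) (avgWindowFactor F.L / (24 * (1 / (10 ^ 34 * (F.L : ℝ))))) ≤ 𝔠.B₃)
    {Ut : (k : ℕ) → GaugeField (F.P K) k (Matrix.specialUnitaryGroup (Fin 2) ℂ) → GaugeField (F.P K) 0 (Matrix.specialUnitaryGroup (Fin 2) ℂ)}
    (hT : AlphaInputsT3AC.TrivMinimiserRowsT3 F 𝔠 γ hγ hγ1 a₀ a₁ K Ut)
    (hU2 : ∀ (k : ℕ), k ≤ K → ∀ (h : Hist (F.P K) k),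
      Hist.Admissible 𝔠.lane.carrier.M₁ (rcolOf (T3Scales F γ hγ (hγ1.trans (sq_min_one_le _ 𝔠.gamma0_pos)) K) 𝔠.lane.carrier) k h →
      ∀ (X : Matrix (Fin 2) (Fin 2) ℂ) (hX : X ∈ (suGroupModel 2).lie), X ≠ 0 →
        profE (T3Scales F γ hγ (hγ1.trans (sq_min_one_le _ 𝔠.gamma0_pos)) K) 𝔠 h hX ∈ AlphaInputsT3AC.large67RecSet F 𝔠 γ hγ hγ1 K k h)
    (hsocket : ∀ (UkH : (k : ℕ) → Hist (F.P K) k → GaugeField (F.P K) k (Matrix.specialUnitaryGroup (Fin 2) ℂ) →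
        GaugeField (F.P K) 0 (Matrix.specialUnitaryGroup (Fin 2) ℂ))
      (hU0 : ∀ V : GaugeField (F.P K) 0 (Matrix.specialUnitaryGroup (Fin 2) ℂ), UkH 0 (Hist.triv (F.P K) 0) V = V),
      AlphaInputsT3AC.InClassSelT3Xs F 𝔠 γ hγ hγ1 K Ut UkH →
      (∀ (k : ℕ), k ≤ K → ∀ (h : Hist (F.P K) k),
        Hist.Admissible 𝔠.lane.carrier.M₁ (rcolOf (T3Scales F γ hγ (hγ1.trans (sq_min_one_le _ 𝔠.gamma0_pos)) K) 𝔠.lane.carrier) k h →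
        h ≠ Hist.triv (F.P K) k → ∀ (W : GaugeField (F.P K) k (Matrix.specialUnitaryGroup (Fin 2) ℂ)),
          IsMinOn (fun U : GaugeField (F.P K) 0 (Matrix.specialUnitaryGroup (Fin 2) ℂ) => wilsonAction4 U)
            (AlphaInputsT3AC.adaptedClassT3Xs F 𝔠 γ hγ hγ1 K k h W) (UkH k h W)) →
      ∃ (𝔖 : ∀ k, StepSeries (T3Scales F γ hγ (hγ1.trans (sq_min_one_le _ 𝔠.gamma0_pos)) K)
          (Matrix.specialUnitaryGroup (Fin 2) ℂ) ↥(lieC (suGroupModel 2))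
          (nblkOf (T3Scales F γ hγ (hγ1.trans (sq_min_one_le _ 𝔠.gamma0_pos)) K) 𝔠.lane.carrier k) k)
        (𝔄 : AlphaDataAC (suGroupModel 2) 𝔠
          (XT3 F γ hγ (hγ1.trans (sq_min_one_le _ 𝔠.gamma0_pos)) K (fun _ => Set.univ)
            (fun k => UkH (k + 1) (Hist.triv (F.P K) (k + 1))) UkH hU0 (fun _ _ => rfl)) 𝔖),
        (∀ k, k + 1 ≤ K → StepDataV3ChiAC (suGroupModel 2) 𝔠
          (XT3 F γ hγ (hγ1.trans (sq_min_one_le _ 𝔠.gamma0_pos)) K (fun _ => Set.univ)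
            (fun k => UkH (k + 1) (Hist.triv (F.P K) (k + 1))) UkH hU0 (fun _ _ => rfl)) 𝔖 𝔄
          (AlphaInputsT3AC.admWindowT3 F 𝔠 γ hγ hγ1 K) k) ∧
        (∀ h : Hist (F.P K) K, Measurable ((inputOfAC 𝔠.lane
          (XT3 F γ hγ (hγ1.trans (sq_min_one_le _ 𝔠.gamma0_pos)) K (fun _ => Set.univ)
            (fun k => UkH (k + 1) (Hist.triv (F.P K) (k + 1))) UkH hU0 (fun _ _ => rfl)) 𝔖).Pint K h)) ∧
        (∀ (h : Hist (F.P K) K) (U : GaugeField (F.P K) K (Matrix.specialUnitaryGroup (Fin 2) ℂ)), (inputOfAC 𝔠.lane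
          (XT3 F γ hγ (hγ1.trans (sq_min_one_le _ 𝔠.gamma0_pos)) K (fun _ => Set.univ)
            (fun k => UkH (k + 1) (Hist.triv (F.P K) (k + 1))) UkH hU0 (fun _ _ => rfl)) 𝔖).Pint K h U ≤ 𝔄.cP K)) :
    AlphaInputsT3AC.DataRowsT3XsChiSel F 𝔠 γ hγ hγ1 K Ut := by
  obtain ⟨UkH, hU0, hsel, hmin⟩ :=
    AlphaInputsT3AC.exists_inClassSelT3Xs_of_trivMinimiserRows_of_sizes_of_profRec ha₁ hA3 hA2 hB₃ hC hCe hCa hM hBfl hγ hγ1 K hT hU2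
  obtain ⟨𝔖, 𝔄, hrows⟩ := hsocket UkH hU0 hsel fun k hk h hh ht W => (hmin k hk h hh ht W).2
  exact ⟨UkH, hU0, hsel, 𝔖, 𝔄, hrows⟩

/-- ★★ **(O‴χₛ) FROM THE ARGMIN SOCKET AT THE RECORD SIZES — NO KINEMATIC ROW LEFT**: `dataRowsT3XsChiSel_of_argminSocket` with (U2) DISCHARGED by ★w4-19936 g5's
`AlphaInputsT3AC.profRec_of_collar` at the collar `collarE_T3_of_M₁_ge hM` ((N2′) from `7L + 3 ≤ M₁`) and `4π ≤ C68` (`four_pi_le_C68_of_sizes hB₃ hC`).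
[cite: Balaban1985UV3, (7) p.257, (40)–(42) p.266, (67)–(68) p.273 and Thm 2 p.272; Balaban1985Variational, Thm 1 (8) p.279] -/
theorem AlphaInputsT3AC.dataRowsT3XsChiSel_of_argminSocket_of_sizes {a₀ a₁ : ℝ} (ha₁ : 0 < a₁)
    (hA3 : (143 * ((((3 + 4 : ℕ) : ℝ)) ^ 2 / 4) ^ 2) * (2 * (𝔠.B₃ * a₁)) ≤ 1 / 3)
    (hA2 : 2 * (2 * (𝔠.B₃ * a₁)) ≤ 2 * deltaSU (Fin 2) / (((3 + 4) * F.L : ℕ) : ℝ) ^ 2)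
    (hB₃ : 1 ≤ 2 * 𝔠.B₃) (hC : 4 * 𝔠.B₃ * (F.L : ℝ) ^ 2 * avgWindowFactor F.L ≤ 𝔠.C68)
    (hCe : Real.exp (𝔠.p₀ - 1) ≤ 3 * C0 3 * 𝔠.C68 * (𝔠.b₀ * Q0 𝔠.p₀))
    (hCa : (𝔠.b₀ * Q0 𝔠.p₀) * (2 * (F.L : ℝ) ^ 2 * avgWindowFactor F.L) ^ 2 ≤ 3 * C0 3 * 𝔠.C68 * a₁ ^ 2)
    (hM : 7 * F.L + 3 ≤ 𝔠.M₁)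
    (hBfl : max (max ((10 : ℝ) ^ 27 + 1) 257 * (F.L : ℝ) ^ 2) (avgWindowFactor F.L / (24 * (1 / (10 ^ 34 * (F.L : ℝ))))) ≤ 𝔠.B₃)
    {Ut : (k : ℕ) → GaugeField (F.P K) k (Matrix.specialUnitaryGroup (Fin 2) ℂ) → GaugeField (F.P K) 0 (Matrix.specialUnitaryGroup (Fin 2) ℂ)}
    (hT : AlphaInputsT3AC.TrivMinimiserRowsT3 F 𝔠 γ hγ hγ1 a₀ a₁ K Ut)
    (hsocket : ∀ (UkH : (k : ℕ) → Hist (F.P K) k → GaugeField (F.P K) k (Matrix.specialUnitaryGroup (Fin 2) ℂ) →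
        GaugeField (F.P K) 0 (Matrix.specialUnitaryGroup (Fin 2) ℂ))
      (hU0 : ∀ V : GaugeField (F.P K) 0 (Matrix.specialUnitaryGroup (Fin 2) ℂ), UkH 0 (Hist.triv (F.P K) 0) V = V),
      AlphaInputsT3AC.InClassSelT3Xs F 𝔠 γ hγ hγ1 K Ut UkH →
      (∀ (k : ℕ), k ≤ K → ∀ (h : Hist (F.P K) k),
        Hist.Admissible 𝔠.lane.carrier.M₁ (rcolOf (T3Scales F γ hγ (hγ1.trans (sq_min_one_le _ 𝔠.gamma0_pos)) K) 𝔠.lane.carrier) k h →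
        h ≠ Hist.triv (F.P K) k → ∀ (W : GaugeField (F.P K) k (Matrix.specialUnitaryGroup (Fin 2) ℂ)),
          IsMinOn (fun U : GaugeField (F.P K) 0 (Matrix.specialUnitaryGroup (Fin 2) ℂ) => wilsonAction4 U)
            (AlphaInputsT3AC.adaptedClassT3Xs F 𝔠 γ hγ hγ1 K k h W) (UkH k h W)) →
      ∃ (𝔖 : ∀ k, StepSeries (T3Scales F γ hγ (hγ1.trans (sq_min_one_le _ 𝔠.gamma0_pos)) K)
          (Matrix.specialUnitaryGroup (Fin 2) ℂ) ↥(lieC (suGroupModel 2))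
          (nblkOf (T3Scales F γ hγ (hγ1.trans (sq_min_one_le _ 𝔠.gamma0_pos)) K) 𝔠.lane.carrier k) k)
        (𝔄 : AlphaDataAC (suGroupModel 2) 𝔠
          (XT3 F γ hγ (hγ1.trans (sq_min_one_le _ 𝔠.gamma0_pos)) K (fun _ => Set.univ)
            (fun k => UkH (k + 1) (Hist.triv (F.P K) (k + 1))) UkH hU0 (fun _ _ => rfl)) 𝔖),
        (∀ k, k + 1 ≤ K → StepDataV3ChiAC (suGroupModel 2) 𝔠
          (XT3 F γ hγ (hγ1.trans (sq_min_one_le _ 𝔠.gamma0_pos)) K (fun _ => Set.univ)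
            (fun k => UkH (k + 1) (Hist.triv (F.P K) (k + 1))) UkH hU0 (fun _ _ => rfl)) 𝔖 𝔄
          (AlphaInputsT3AC.admWindowT3 F 𝔠 γ hγ hγ1 K) k) ∧
        (∀ h : Hist (F.P K) K, Measurable ((inputOfAC 𝔠.lane
          (XT3 F γ hγ (hγ1.trans (sq_min_one_le _ 𝔠.gamma0_pos)) K (fun _ => Set.univ)
            (fun k => UkH (k + 1) (Hist.triv (F.P K) (k + 1))) UkH hU0 (fun _ _ => rfl)) 𝔖).Pint K h)) ∧
        (∀ (h : Hist (F.P K) K) (U : GaugeField (F.P K) K (Matrix.specialUnitaryGroup (Fin 2) ℂ)), (inputOfAC 𝔠.lane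
          (XT3 F γ hγ (hγ1.trans (sq_min_one_le _ 𝔠.gamma0_pos)) K (fun _ => Set.univ)
            (fun k => UkH (k + 1) (Hist.triv (F.P K) (k + 1))) UkH hU0 (fun _ _ => rfl)) 𝔖).Pint K h U ≤ 𝔄.cP K)) :
    AlphaInputsT3AC.DataRowsT3XsChiSel F 𝔠 γ hγ hγ1 K Ut :=
  AlphaInputsT3AC.dataRowsT3XsChiSel_of_argminSocket ha₁ hA3 hA2 hB₃ hC hCe hCa hM hBfl hT
    (AlphaInputsT3AC.profRec_of_collar (AlphaInputsT3AC.collarE_T3_of_M₁_ge (hγ := hγ) (hγ1 := hγ1) (K := K) hM)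
      (AlphaInputsT3AC.four_pi_le_C68_of_sizes (F := F) hB₃ hC)) hsocket

end T3

/-! ## §2 The same at the record sizes with (U2) discharged, along `hF : F.L = L` (the door's `hF ▸ 𝔠` letters) -/

section Cast

/-- ★★ **(O‴χₛ) FROM THE ARGMIN SOCKET AT THE RECORD SIZES, NO KINEMATIC ROW LEFT**, for a record `𝔠 : AlphaConsts L _` read at a family with `F.L = L` (the door's
`hF ▸ 𝔠` letters): `dataRowsT3XsChiSel_of_argminSocket` after `subst`, with (U2) DISCHARGED by ★w4-19936 g5's `AlphaInputsT3AC.profRec_of_collar` at the collar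
`collarE_T3_of_M₁_ge hM` and `4π ≤ C68` (`four_pi_le_C68_of_sizes hB₃ hC`). [cite: Balaban1985UV3, (7) p.257, (40)–(42) p.266, (67)–(68) p.273 and Thm 2 p.272] -/
theorem AlphaInputsT3AC.dataRowsT3XsChiSel_of_argminSocket_of_sizes_cast {L : ℕ} {𝔠 : AlphaConsts L (suGroupModel 2).N} {a₀ a₁ : ℝ} (ha₁ : 0 < a₁)
    (hA3 : (143 * ((((3 + 4 : ℕ) : ℝ)) ^ 2 / 4) ^ 2) * (2 * (𝔠.B₃ * a₁)) ≤ 1 / 3)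
    (hA2 : 2 * (2 * (𝔠.B₃ * a₁)) ≤ 2 * deltaSU (Fin 2) / (((3 + 4) * L : ℕ) : ℝ) ^ 2)
    (hB₃ : 1 ≤ 2 * 𝔠.B₃) (hC : 4 * 𝔠.B₃ * (L : ℝ) ^ 2 * avgWindowFactor L ≤ 𝔠.C68)
    (hCe : Real.exp (𝔠.p₀ - 1) ≤ 3 * C0 3 * 𝔠.C68 * (𝔠.b₀ * Q0 𝔠.p₀))
    (hCa : (𝔠.b₀ * Q0 𝔠.p₀) * (2 * (L : ℝ) ^ 2 * avgWindowFactor L) ^ 2 ≤ 3 * C0 3 * 𝔠.C68 * a₁ ^ 2)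
    (hM : 7 * L + 3 ≤ 𝔠.M₁)
    (hBfl : max (max ((10 : ℝ) ^ 27 + 1) 257 * (L : ℝ) ^ 2) (avgWindowFactor L / (24 * (1 / (10 ^ 34 * (L : ℝ))))) ≤ 𝔠.B₃)
    (F : T3Family) (hF : F.L = L) {γ : ℝ} (hγ : 0 < γ) (hγ1 : γ ≤ (min (hF ▸ 𝔠).gamma0 1) ^ 2) (K : ℕ)
    {Ut : (k : ℕ) → GaugeField (F.P K) k (Matrix.specialUnitaryGroup (Fin 2) ℂ) → GaugeField (F.P K) 0 (Matrix.specialUnitaryGroup (Fin 2) ℂ)}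
    (hT : AlphaInputsT3AC.TrivMinimiserRowsT3 F (hF ▸ 𝔠) γ hγ hγ1 a₀ a₁ K Ut)
    (hsocket : ∀ (UkH : (k : ℕ) → Hist (F.P K) k → GaugeField (F.P K) k (Matrix.specialUnitaryGroup (Fin 2) ℂ) →
        GaugeField (F.P K) 0 (Matrix.specialUnitaryGroup (Fin 2) ℂ))
      (hU0 : ∀ V : GaugeField (F.P K) 0 (Matrix.specialUnitaryGroup (Fin 2) ℂ), UkH 0 (Hist.triv (F.P K) 0) V = V),
      AlphaInputsT3AC.InClassSelT3Xs F (hF ▸ 𝔠) γ hγ hγ1 K Ut UkH →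
      (∀ (k : ℕ), k ≤ K → ∀ (h : Hist (F.P K) k),
        Hist.Admissible (hF ▸ 𝔠).lane.carrier.M₁ (rcolOf (T3Scales F γ hγ (hγ1.trans (sq_min_one_le _ (hF ▸ 𝔠).gamma0_pos)) K) (hF ▸ 𝔠).lane.carrier) k h →
        h ≠ Hist.triv (F.P K) k → ∀ (W : GaugeField (F.P K) k (Matrix.specialUnitaryGroup (Fin 2) ℂ)),
          IsMinOn (fun U : GaugeField (F.P K) 0 (Matrix.specialUnitaryGroup (Fin 2) ℂ) => wilsonAction4 U)
            (AlphaInputsT3AC.adaptedClassT3Xs F (hF ▸ 𝔠) γ hγ hγ1 K k h W) (UkH k h W)) →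
      ∃ (𝔖 : ∀ k, StepSeries (T3Scales F γ hγ (hγ1.trans (sq_min_one_le _ (hF ▸ 𝔠).gamma0_pos)) K)
          (Matrix.specialUnitaryGroup (Fin 2) ℂ) ↥(lieC (suGroupModel 2))
          (nblkOf (T3Scales F γ hγ (hγ1.trans (sq_min_one_le _ (hF ▸ 𝔠).gamma0_pos)) K) (hF ▸ 𝔠).lane.carrier k) k)
        (𝔄 : AlphaDataAC (suGroupModel 2) (hF ▸ 𝔠)
          (XT3 F γ hγ (hγ1.trans (sq_min_one_le _ (hF ▸ 𝔠).gamma0_pos)) K (fun _ => Set.univ)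
            (fun k => UkH (k + 1) (Hist.triv (F.P K) (k + 1))) UkH hU0 (fun _ _ => rfl)) 𝔖),
        (∀ k, k + 1 ≤ K → StepDataV3ChiAC (suGroupModel 2) (hF ▸ 𝔠)
          (XT3 F γ hγ (hγ1.trans (sq_min_one_le _ (hF ▸ 𝔠).gamma0_pos)) K (fun _ => Set.univ)
            (fun k => UkH (k + 1) (Hist.triv (F.P K) (k + 1))) UkH hU0 (fun _ _ => rfl)) 𝔖 𝔄
          (AlphaInputsT3AC.admWindowT3 F (hF ▸ 𝔠) γ hγ hγ1 K) k) ∧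
        (∀ h : Hist (F.P K) K, Measurable ((inputOfAC (hF ▸ 𝔠).lane
          (XT3 F γ hγ (hγ1.trans (sq_min_one_le _ (hF ▸ 𝔠).gamma0_pos)) K (fun _ => Set.univ)
            (fun k => UkH (k + 1) (Hist.triv (F.P K) (k + 1))) UkH hU0 (fun _ _ => rfl)) 𝔖).Pint K h)) ∧
        (∀ (h : Hist (F.P K) K) (U : GaugeField (F.P K) K (Matrix.specialUnitaryGroup (Fin 2) ℂ)), (inputOfAC (hF ▸ 𝔠).lane
          (XT3 F γ hγ (hγ1.trans (sq_min_one_le _ (hF ▸ 𝔠).gamma0_pos)) K (fun _ => Set.univ)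
            (fun k => UkH (k + 1) (Hist.triv (F.P K) (k + 1))) UkH hU0 (fun _ _ => rfl)) 𝔖).Pint K h U ≤ 𝔄.cP K)) :
    AlphaInputsT3AC.DataRowsT3XsChiSel F (hF ▸ 𝔠) γ hγ hγ1 K Ut := by
  subst hF
  exact AlphaInputsT3AC.dataRowsT3XsChiSel_of_argminSocket_of_sizes ha₁ hA3 hA2 hB₃ hC hCe hCa hM hBfl hT hsocket

end Cast

end Summit.QuantumFields.YangMills.Theorems

/-! ## §3 The door v1.2 — `HistoryTailL` from (T) and NODE O's rows FOR AN IN-CLASS ARGMIN -/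

namespace Summit.QuantumFields.YangMills.Theorems.HistoryTailLaneTailV4Chi

open MeasureTheory Set
open scoped Matrix Matrix.Norms.L2Operator
open Literature.MathematicalPhysics.QuantumFieldTheory.Balaban1983to89
open Literature.MathematicalPhysics.QuantumFieldTheory.Balaban1983to89.T3ContinuumYM3Torus
open Literature.MathematicalPhysics.QuantumFieldTheory.Balaban1983to89.T3PrintedMinimiserExistence (Thm1GlobalMinAt)
open Literature.MathematicalPhysics.QuantumFieldTheory.Balaban1983to89.T3LowerAlongMinimisersSplit (MinimisersIn8At)
open Literature.MathematicalPhysics.QuantumFieldTheory.Balaban1983to89.ExpMeanLog (deltaSU)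
open Literature.MathematicalPhysics.QuantumFieldTheory.Balaban1985CMP102
open Literature.MathematicalPhysics.QuantumFieldTheory.Balaban1985CMP102.Setting
open Summit.QuantumFields.Balaban3D.Carriers
open Summit.QuantumFields.Balaban3D.Proofs.Primitives
open Summit.QuantumFields.Balaban3D.Proofs.GroupModelLieC (lieC)
open Summit.QuantumFields.Balaban3D.Proofs.TowerAC
open Summit.QuantumFields.Balaban3D.Proofs.StandardAC
open Summit.QuantumFields.Balaban3D.Proofs.InputsAC
open Summit.QuantumFields.Balaban3D.Proofs.AlphaAC (AlphaDataAC)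
open Summit.QuantumFields.Balaban3D.Proofs.Thresholds (Q0)
open Summit.QuantumFields.YangMills.Theorems
open Summit.QuantumFields.YangMills.Theorems.AlphaV3AC
open Summit.QuantumFields.YangMills.Theorems.ProfileEnlarged (profE)
open B7Prop2Explicit (C0)

/-- The `B₃`-floor of the selection theorem as a function of the block size (the door absorbs it into the supplier's floor). [cite: Balaban1985UV3, (28) p.263 (bookkeeping)] -/
private theorem b3Floor_le_of_le {L : ℕ} {B₀ B : ℝ}
    (hB : max B₀ (max (max ((10 : ℝ) ^ 27 + 1) 257 * (L : ℝ) ^ 2) (avgWindowFactor L / (24 * (1 / (10 ^ 34 * (L : ℝ)))))) ≤ B) :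
    B₀ ≤ B ∧ max (max ((10 : ℝ) ^ 27 + 1) 257 * (L : ℝ) ^ 2) (avgWindowFactor L / (24 * (1 / (10 ^ 34 * (L : ℝ))))) ≤ B :=
  ⟨(le_max_left _ _).trans hB, (le_max_right _ _).trans hB⟩

/-- ★★★ **THE DOOR v1.2 — `HistoryTailL` ⇐ ⟨`stub_thm1In8GlobalMin`'s TEXT at every odd `L > 1`⟩ ∧ ⟨per odd `L`: a floor `B₀` and a box `(0, A₀] × (0, A₁]` on which, for every
`B ≥ B₀` in the [7]-window and every profile beyond thresholds, a record `𝔠` with that profile, `𝔠.B₃ = B`, the three `C68`-rows and the collar `7L + 3 ≤ 𝔠.M₁` is served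
together with, per family `F` (`F.L = L`): the seam row (71)_sym at every `(γ, K)`, and at every `(γ, K)`, for every handed trivial-history family `Ut`, NODE O's three χ-data
conjuncts FOR EVERY MEASURABLE IN-CLASS ARGMIN SELECTION pinned to `Ut`⟩.**  = the door of record ✓`historyTailL_of_thm1In8_selXsV4DataRows_allL` with the selection-existence
conjunct of (O‴χₛ) DISCHARGED (✓`exists_inClassSelT3Xs_of_trivMinimiserRows_of_sizes_of_profRec` ∘ ✓`profRec_of_collar`, the `B₃`-floor absorbed into `B₀`).  CONDITIONAL — (T) and
NODE O's rows are displayed, not proved. [cite: Balaban1985UV3, (5) p.256, (42) p.266, (47) p.267, (67)–(71) p.273 and Thm 2 p.272; Balaban1985Variational, Thm 1 (6)–(8) pp.278–279 and Prop 8 p.304] -/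
theorem historyTailL_of_thm1In8_xsArgminRows_allL
    (hT8 : ∀ L : ℕ, Odd L → 1 < L → ∃ a₀ a₁ B₃ : ℝ, 0 < a₀ ∧ 0 < a₁ ∧ 0 < B₃ ∧
      Thm1GlobalMinAt L a₀ a₁ B₃ ∧ MinimisersIn8At L a₀ a₁ B₃)
    (hrows : ∀ L : ℕ, Odd L → 1 < L → ∃ (B₀ A₀ A₁ : ℝ), 0 < A₀ ∧ 0 < A₁ ∧
      ∀ (B a₀ a₁ : ℝ), B₀ ≤ B → 1 ≤ 2 * B → 0 < a₀ → a₀ ≤ A₀ → 0 < a₁ → a₁ ≤ A₁ → B * a₁ ≤ a₀ →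
        (143 * ((((3 + 4 : ℕ) : ℝ)) ^ 2 / 4) ^ 2) * (2 * (B * a₁)) ≤ 1 / 3 →
        2 * (2 * (B * a₁)) ≤ 2 * deltaSU (Fin 2) / (((3 + 4) * L : ℕ) : ℝ) ^ 2 →
        Thm1GlobalMinAt L a₀ a₁ B →
        ∃ (b₁ p₁ : ℝ), ∀ (b₀ p₀ : ℝ), b₁ ≤ b₀ → p₁ ≤ p₀ →
          ∃ 𝔠 : AlphaConsts L (suGroupModel 2).N, 𝔠.b₀ = b₀ ∧ 𝔠.p₀ = p₀ ∧ 𝔠.B₃ = B ∧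
            4 * 𝔠.B₃ * (L : ℝ) ^ 2 * avgWindowFactor L ≤ 𝔠.C68 ∧
            Real.exp (𝔠.p₀ - 1) ≤ 3 * C0 3 * 𝔠.C68 * (𝔠.b₀ * Q0 𝔠.p₀) ∧
            (𝔠.b₀ * Q0 𝔠.p₀) * (2 * (L : ℝ) ^ 2 * avgWindowFactor L) ^ 2 ≤ 3 * C0 3 * 𝔠.C68 * a₁ ^ 2 ∧
            7 * L + 3 ≤ 𝔠.M₁ ∧
            ∀ (F : T3Family) (hF : F.L = L),
              (∀ (γ : ℝ) (hγ : 0 < γ) (hγ1 : γ ≤ (min (hF ▸ 𝔠).gamma0 1) ^ 2) (K : ℕ),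
                AlphaInputsT3AC.SmallFactor71OfRecT3 F (hF ▸ 𝔠) γ hγ hγ1 K) ∧
              ∀ (γ : ℝ) (hγ : 0 < γ) (hγ1 : γ ≤ (min (hF ▸ 𝔠).gamma0 1) ^ 2) (K : ℕ)
                (Ut : (k : ℕ) → GaugeField (F.P K) k (Matrix.specialUnitaryGroup (Fin 2) ℂ) →
                    GaugeField (F.P K) 0 (Matrix.specialUnitaryGroup (Fin 2) ℂ)),
                AlphaInputsT3AC.TrivMinimiserRowsT3 F (hF ▸ 𝔠) γ hγ hγ1 a₀ a₁ K Ut →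
                  ∀ (UkH : (k : ℕ) → Hist (F.P K) k → GaugeField (F.P K) k (Matrix.specialUnitaryGroup (Fin 2) ℂ) →
                      GaugeField (F.P K) 0 (Matrix.specialUnitaryGroup (Fin 2) ℂ))
                    (hU0 : ∀ V : GaugeField (F.P K) 0 (Matrix.specialUnitaryGroup (Fin 2) ℂ), UkH 0 (Hist.triv (F.P K) 0) V = V),
                    AlphaInputsT3AC.InClassSelT3Xs F (hF ▸ 𝔠) γ hγ hγ1 K Ut UkH →
                    (∀ (k : ℕ), k ≤ K → ∀ (h : Hist (F.P K) k),
                      Hist.Admissible (hF ▸ 𝔠).lane.carrier.M₁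
                        (rcolOf (T3Scales F γ hγ (hγ1.trans (sq_min_one_le _ (hF ▸ 𝔠).gamma0_pos)) K) (hF ▸ 𝔠).lane.carrier) k h →
                      h ≠ Hist.triv (F.P K) k → ∀ (W : GaugeField (F.P K) k (Matrix.specialUnitaryGroup (Fin 2) ℂ)),
                        IsMinOn (fun U : GaugeField (F.P K) 0 (Matrix.specialUnitaryGroup (Fin 2) ℂ) => wilsonAction4 U)
                          (AlphaInputsT3AC.adaptedClassT3Xs F (hF ▸ 𝔠) γ hγ hγ1 K k h W) (UkH k h W)) →
                    ∃ (𝔖 : ∀ k, StepSeries (T3Scales F γ hγ (hγ1.trans (sq_min_one_le _ (hF ▸ 𝔠).gamma0_pos)) K)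
                        (Matrix.specialUnitaryGroup (Fin 2) ℂ) ↥(lieC (suGroupModel 2))
                        (nblkOf (T3Scales F γ hγ (hγ1.trans (sq_min_one_le _ (hF ▸ 𝔠).gamma0_pos)) K) (hF ▸ 𝔠).lane.carrier k) k)
                      (𝔄 : AlphaDataAC (suGroupModel 2) (hF ▸ 𝔠)
                        (XT3 F γ hγ (hγ1.trans (sq_min_one_le _ (hF ▸ 𝔠).gamma0_pos)) K (fun _ => Set.univ)
                          (fun k => UkH (k + 1) (Hist.triv (F.P K) (k + 1))) UkH hU0 (fun _ _ => rfl)) 𝔖),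
                      (∀ k, k + 1 ≤ K → StepDataV3ChiAC (suGroupModel 2) (hF ▸ 𝔠)
                        (XT3 F γ hγ (hγ1.trans (sq_min_one_le _ (hF ▸ 𝔠).gamma0_pos)) K (fun _ => Set.univ)
                          (fun k => UkH (k + 1) (Hist.triv (F.P K) (k + 1))) UkH hU0 (fun _ _ => rfl)) 𝔖 𝔄
                        (AlphaInputsT3AC.admWindowT3 F (hF ▸ 𝔠) γ hγ hγ1 K) k) ∧
                      (∀ h : Hist (F.P K) K, Measurable ((inputOfAC (hF ▸ 𝔠).lane
                        (XT3 F γ hγ (hγ1.trans (sq_min_one_le _ (hF ▸ 𝔠).gamma0_pos)) K (fun _ => Set.univ)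
                          (fun k => UkH (k + 1) (Hist.triv (F.P K) (k + 1))) UkH hU0 (fun _ _ => rfl)) 𝔖).Pint K h)) ∧
                      (∀ (h : Hist (F.P K) K) (U : GaugeField (F.P K) K (Matrix.specialUnitaryGroup (Fin 2) ℂ)), (inputOfAC (hF ▸ 𝔠).lane
                        (XT3 F γ hγ (hγ1.trans (sq_min_one_le _ (hF ▸ 𝔠).gamma0_pos)) K (fun _ => Set.univ)
                          (fun k => UkH (k + 1) (Hist.triv (F.P K) (k + 1))) UkH hU0 (fun _ _ => rfl)) 𝔖).Pint K h U ≤ 𝔄.cP K)) :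
    Summit.QuantumFields.YangMills.Theses.UnitScaleTilt.HistoryTailL := by
  refine historyTailL_of_thm1In8_selXsV4DataRows_allL hT8 fun L hLo hL => ?_
  obtain ⟨B₀, A₀, A₁, hA₀, hA₁, h⟩ := hrows L hLo hL
  refine ⟨max B₀ (max (max ((10 : ℝ) ^ 27 + 1) 257 * (L : ℝ) ^ 2) (avgWindowFactor L / (24 * (1 / (10 ^ 34 * (L : ℝ)))))),
    A₀, A₁, hA₀, hA₁, fun B a₀ a₁ hB h2B ha₀ ha₀A ha₁ ha₁A hwin hA3 hA2 hT => ?_⟩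
  obtain ⟨hB₀, hBfl⟩ := b3Floor_le_of_le hB
  obtain ⟨b₁, p₁, hrec⟩ := h B a₀ a₁ hB₀ h2B ha₀ ha₀A ha₁ ha₁A hwin hA3 hA2 hT
  refine ⟨b₁, p₁, fun b₀ p₀ hb hp => ?_⟩
  obtain ⟨𝔠, h1, h2, hB3, s1, s2, s3, hM, hFO⟩ := hrec b₀ p₀ hb hp
  refine ⟨𝔠, h1, h2, hB3, s1, s2, s3, fun F hF => ⟨(hFO F hF).1, fun γ hγ hγ1 K hex => ?_⟩⟩
  obtain ⟨Ut, hUt⟩ := hex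
  exact ⟨Ut, hUt, AlphaInputsT3AC.dataRowsT3XsChiSel_of_argminSocket_of_sizes_cast ha₁ (by rw [hB3]; exact hA3) (by rw [hB3]; exact hA2)
    (by rw [hB3]; exact h2B) s1 s2 s3 hM (by rw [hB3]; exact hBfl) F hF hγ hγ1 K hUt ((hFO F hF).2 γ hγ hγ1 K Ut hUt)⟩

end Summit.QuantumFields.YangMills.Theorems.HistoryTailLaneTailV4Chi

end
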